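import Summits.BirchSwinnertonDyer.BirchSwinnertonDyer.Theorems.RankLeOneBSDpOfGlobalDivisibilityCertificate
import Literature.NumberTheory.EllipticCurves.BSDQuadraticDescentShaOddPartGeneralProofs
import HarnessLib

/-!
# CERTIFICATE currency with INDEX EXCESS (any odd `p ∣ N_E`, `ρ̄_{E,p}` irreducible, non-CM): global
# divisibility (J) + the index certificate `ord_p[E(K):ℤy_K] ≤ ord_p ∏_ℓ c_ℓ(E) + s + e` + `p`-DESCENT lower
# certificates on `Ш(E/ℚ)` and `Ш(E^{d_K}/ℚ)` ⟹ the EXACT `p`-parts of both `Ш`'s ⟹ `BSD_p(E)` and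
# `BSD_p(E^{d_K})` from the analytic certificates — the INDEX-EXCESS and SHA3-AN rows of the census need NO
# main-conjecture input in referee A's currency (route-free; seat `bsd-wall-utd-p3` gen 1; file 5)

Sequel of `RankLeOneBSDpOfGlobalDivisibilityCertificate.lean` (p546379/p547200: excess `e = 0`). The
upper socket produced by J (`upper_of_globalDivisibility_of_irr`) reads, through the odd-primary
decomposition `#Ш(E/K)[p^∞] = #Ш(E/ℚ)[p^∞]·#Ш(E^{d_K}/ℚ)[p^∞]` (tree theorem
`WeierstrassCurve.card_primaryComponent_sha_baseChange_quadratic_of_odd_of_finite`, JSW 2017 §7.4.1 /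
Dokchitser–Dokchitser 2010 Lemma 4.14, any rank), as the JOINT upper bound
`ord_p #Ш(E) + ord_p #Ш(E^{d_K}) + 2·ord_p ∏_ℓ c_ℓ(E) + 2s ≤ 2·ord_p [E(K):ℤP]`
(`padicValNat_shaOrder_add_twist_le_of_globalDivisibility`). With an index certificate of EXCESS `e`
(`ord_p [E(K):ℤP] ≤ ord_p ∏c + s + e`) the joint `p`-part is `≤ 2e`; LOWER certificates `a ≤ ord_p #Ш(E)`,
`b ≤ ord_p #Ш(E^{d_K})` with `a + b = 2e` — FINITE computations: a `p`-descent (`#Sel_p(X) = #Ш(X)[p]` when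
`X(ℚ)` is finite without `p`-torsion; in rank one `dim Sel_p(E) − 1`) or exhibited `Ш`-classes — then pin
BOTH `p`-parts exactly (`padicValNat_shaOrder_eq_of_globalDivisibility_of_certificates`), and the analytic
certificates `ord_p #Ш_an(E) = a`, `ord_p #Ш_an(E^{d_K}) = b` give `BSDp W p` and `BSDp Wd p`
(`bsdp_of_globalDivisibility_of_excess_certificates`, `partner_bsdp_of_globalDivisibility_of_excess_certificates`).

PARTITION currency (census `blockA/BLOCK-A-index.md` T16/T17 READ; referee A's book at `3`): beyond file 4's
JET rows (4 724), the INDEX-EXCESS rows — onto **630** (W 472 · T′ 134 · Gss2 24; census g11: the excess IS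
`√#Ш_an(E^D)`, `ord₃ #Ш_an(E^D) ∈ {2, 4, 6}`) + normaliser 1 — are typed here as «J + a `3`-descent lower
certificate on `E^{d_K}` + `Ш_an(E)` `3`-free», and the SHA3-AN rows (onto **25**) as «J + `3`-descent lower
certificates on `E` (and `E^{d_K}`) + `ord₃ #Ш_an(E) = 2`»: in CERTIFICATE currency the whole onto / normaliser
rank-one block A at `3` (4 882 + 498 classes) is ONE displayed Kolyvagin-side statement (J) + finite descent
certificates + print — NO Eisenstein / main-conjecture input (that input, crux E of route
`SemiOrdinaryEisensteinDescent`, stays load-bearing in CLASS currency). Classes closed: 0 (J OPEN);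
«beyond-print theorem»: NO. HONEST FRAMING: CONDITIONAL on `hglob` and the named facts (hypotheses); the
numerical inputs are certificates the kernel does not produce; per pair; BSD is not proved for any curve by
this file. No definition, no named fact, no `sorry`.

References: [Jetchev2008] Conj. 1.3, Cor. 1.5 and (1) (p. 812); [JetchevSkinnerWan2017] §7.4.1
(arXiv:1512.06894 p. 30); [DokchitserDokchitserAnnals2010] Lemma 4.14; [MatarNekovar2019] Thm. 0.7, §0.11;
[Miller2011LMS] Def. 1.1; [GrossLMS1991] Prop. 2.1, (2.4); [SchaeferStoll2004] (`p`-descent certificates).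
-/

noncomputable section

open scoped Classical

set_option linter.dupNamespace false
set_option autoImplicit false

namespace Summit.BirchSwinnertonDyer.BirchSwinnertonDyer.Theorems.SchneiderFree.Exact

open WeierstrassCurve NumberField IsDedekindDomain Field
  Literature.NumberTheory.EllipticCurves
  Literature.NumberTheory.EllipticCurves.ModularForms
  Literature.NumberTheory.EllipticCurves.Rank1Residual
  Literature.NumberTheory.EllipticCurves.Rank1Residual.Typed
  Literature.NumberTheory.EllipticCurves.KrizLi2019
  Summit.BirchSwinnertonDyer.Rank1Residual
  Summit.BirchSwinnertonDyer.Rank1Residual.X11b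
  Summit.BirchSwinnertonDyer.Rank1Residual.X11b.Three

/-! ### §1 The odd `p`-part of `Ш(E/K)` is the sum of those of `Ш(E/ℚ)` and `Ш(E^{d_K}/ℚ)` -/

/-- **`ord_p #Ш(E/K) = ord_p #Ш(E/ℚ) + ord_p #Ш(E^{d_K}/ℚ)` for odd `p`** when all three groups are finite
(`K` imaginary quadratic, `Wd` any `ℚ`-model of the twist): the order form of
`Ш(E/K)[p^∞] ≅ Ш(E/ℚ)[p^∞] ⊕ Ш(E^{d_K}/ℚ)[p^∞]` (tree theorem
`card_primaryComponent_sha_baseChange_quadratic_of_odd_of_finite`) read through `ord_p #A = ord_p #A[p^∞]`.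
[cite: JetchevSkinnerWan2017, §7.4.1 (arXiv:1512.06894 p. 30)] [cite: DokchitserDokchitserAnnals2010, Lemma 4.14] -/
theorem padicValNat_shaOrder_baseChange_eq_add_twist
    (W : WeierstrassCurve ℚ) [W.IsElliptic] (K : Type) [Field K] [NumberField K]
    (hK : IsImaginaryQuadratic K) (Wd : WeierstrassCurve ℚ) [Wd.IsElliptic]
    (hC : ∃ C : VariableChange ℚ, C • W.quadraticTwist (NumberField.discr K : ℚ) = Wd)
    (p : ℕ) [Fact p.Prime] (hp2 : p ≠ 2)
    [Finite W.sha] [Finite Wd.sha] [Finite (W.baseChange K).sha] :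
    padicValNat p (W.baseChange K).shaOrder = padicValNat p W.shaOrder + padicValNat p Wd.shaOrder := by
  haveI : (W.baseChange K).IsElliptic := by rw [baseChange]; infer_instance
  have hcard := card_primaryComponent_sha_baseChange_quadratic_of_odd_of_finite W K hK.1 Wd hC
    (W.baseChange K) ⟨1, one_smul _ _⟩ p hp2
  have h1 : Nat.card (AddCommGroup.primaryComponent W.sha p) ≠ 0 := Nat.card_pos.ne'
  have h2 : Nat.card (AddCommGroup.primaryComponent Wd.sha p) ≠ 0 := Nat.card_pos.ne'
  rw [Koly.padicValNat_shaOrder_eq (W.baseChange K) p, Koly.padicValNat_shaOrder_eq W p,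
    Koly.padicValNat_shaOrder_eq Wd p, hcard, padicValNat.mul h1 h2]

/-! ### §2 The JOINT upper bound from global divisibility -/

/-- **J ⟹ `ord_p #Ш(E/ℚ) + ord_p #Ш(E^{d_K}/ℚ) + 2·ord_p ∏_ℓ c_ℓ(E) + 2s ≤ 2·ord_p [E(K):ℤP]`** (odd `p`,
`ρ̄_{E,p}` irreducible, non-CM, `r_an(E) = 1`, `K` imaginary quadratic Heegner for `N_E` with `d_K ∉ {−3,−4}`,
`L(E^{d_K},1) ≠ 0`, `Wd` a `ℚ`-model of the twist, `P` the Heegner point of `(Dt, H, ι)`): the upper socket of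
`upper_of_globalDivisibility_of_irr` (J displayed as `hglob`; Matar–Nekovář and Kolyvagin named) read
through §1; `Ш(E/ℚ)`, `Ш(E^{d_K}/ℚ)` finite by GZK (analytic ranks `1`, `0`), `Ш(E/K)` by Kolyvagin, `P`
non-torsion by Gross–Zagier. [cite: Jetchev2008, Cor. 1.5 and (1) (p. 812)]
[cite: JetchevSkinnerWan2017, §7.4.1 (arXiv:1512.06894 p. 30)] [cite: MatarNekovar2019, Thm. 0.7 (p. 456) and §0.11 (p. 457)] -/
theorem padicValNat_shaOrder_add_twist_le_of_globalDivisibility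
    (hGZ : ∀ (N : ℕ) [NeZero N] (W : WeierstrassCurve ℚ) (K : Type) [Field K] [NumberField K],
      gross_zagier N W K)
    (hKo : ∀ (N : ℕ) [NeZero N] (W : WeierstrassCurve ℚ) (K : Type) [Field K] [NumberField K],
      kolyvagin N W K)
    (hGZK : rank_eq_analyticRank_of_analyticRank_le_one) (hmod : hasEntireLFunction_rat)
    (hMN : MatarNekovar2019.thm07_padicValNat_card_sha_primary_add_le_of_globalDivisibility_of_irreducible)
    (W : WeierstrassCurve ℚ) [W.IsElliptic] [W.IsGloballyMinimal] [NeZero (W.conductorNorm ℤ)]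
    (hCM : ¬ W.HasCM) (p : ℕ) [Fact p.Prime] (hp2 : p ≠ 2) (hirr : W.HasIrreducibleModPGaloisRep p)
    (hr : W.analyticRank = 1)
    (K : Type) [Field K] [NumberField K] (hK : IsImaginaryQuadratic K)
    (h3 : NumberField.discr K ≠ -3) (h4 : NumberField.discr K ≠ -4)
    (hHH : SatisfiesHeegnerHypothesis (W.conductorNorm ℤ) K)
    (Dt : ModularParametrizationData W (W.conductorNorm ℤ))
    (H : HeegnerDatum (W.conductorNorm ℤ) (NumberField.discr K)) (ι : K →+* ℂ)
    (P : (W.baseChange K).toAffine.Point) (Wd : WeierstrassCurve ℚ) [Wd.IsElliptic]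
    (hLd : (W.quadraticTwist (NumberField.discr K : ℚ)).entireLFunction 1 ≠ 0)
    (hP : WeierstrassCurve.Affine.Point.map ι.toRatAlgHom P = heegnerPointComplex Dt H)
    (hC : ∃ C : VariableChange ℚ, C • W.quadraticTwist (NumberField.discr K : ℚ) = Wd) {s : ℕ}
    (hglob : ∀ (s' : ℕ), s' ≤ padicValNat p W.tamagawaProduct + s →
      ∀ (n : ℕ) (d : KolyvaginHeegnerData Dt H.β ι n), Squarefree n →
        (∀ ℓ ∈ n.primeFactors, Zhang2014.IsKolyvaginPrime (W.conductorNorm ℤ) W K p ℓ ∧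
          s' ≤ Zhang2014.kolyvaginIndex W p ℓ) → Koly.PDiv d p s') :
    padicValNat p W.shaOrder + padicValNat p Wd.shaOrder + 2 * padicValNat p W.tamagawaProduct + 2 * s ≤
      2 * padicValNat p (AddSubgroup.zmultiples P).index := by
  -- the Heegner point is non-torsion (Gross–Zagier)
  have hL0 : W.entireLFunction 1 = 0 := entireLFunction_one_eq_zero_of_analyticRank_eq_one hr
  obtain ⟨-, hderiv⟩ := leadingLCoeff_eq_deriv_of_analyticRank_eq_one hr
  have hLK : LDerivEK W K ≠ 0 := by
    rw [lDerivEK_eq_deriv_mul W K hmod hL0]; exact mul_ne_zero hderiv hLd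
  have hnt : ¬ IsOfFinAddOrder P :=
    (lDerivEK_ne_zero_iff_not_isOfFinAddOrder W (W.conductorNorm ℤ) K (hGZ _ W K) hK hHH
      ⟨Dt, H, ι, hP⟩).mp hLK
  -- the upper socket over `K`
  have hup : Upper.IndexUpperBoundLeAt W p K P s :=
    upper_of_globalDivisibility_of_irr hKo hMN W hCM p hp2 hirr K hK h3 h4 hHH Dt H ι P hP hnt hglob
  -- finiteness of the three `Ш`'s
  obtain ⟨-, hfinK⟩ := hKo (W.conductorNorm ℤ) W K hK hHH ⟨Dt, H, ι, hP⟩ hnt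
  haveI : Finite (W.baseChange K).sha := hfinK
  haveI : Finite W.sha := (hGZK W hr.le).2
  obtain ⟨Cd, hCd⟩ := hC
  have hD0 : (NumberField.discr K : ℚ) ≠ 0 := by exact_mod_cast NumberField.discr_ne_zero K
  haveI : (W.quadraticTwist (NumberField.discr K : ℚ)).IsElliptic := W.isElliptic_quadraticTwist hD0
  have hLd1 : Wd.entireLFunction 1 ≠ 0 := by rw [← hCd, entireLFunction_smul]; exact hLd
  have hrd : Wd.analyticRank = 0 := analyticRank_eq_zero_of_entireLFunction_one_ne_zero Wd hLd1
  haveI : Finite Wd.sha := (hGZK Wd (by rw [hrd]; exact zero_le_one)).2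
  have hsum := padicValNat_shaOrder_baseChange_eq_add_twist W K hK Wd ⟨Cd, hCd⟩ p hp2
  unfold Upper.IndexUpperBoundLeAt at hup
  omega

/-! ### §3 Excess `e` and the descent certificates: both `p`-parts EXACTLY, then `BSD_p` of both curves -/

/-- **EXACT `p`-parts of `Ш(E/ℚ)` and `Ш(E^{d_K}/ℚ)` from J + an index certificate of excess `e` + two lower
certificates.** Data as in §2; certificates: `ord_p [E(K):ℤP] ≤ ord_p ∏_ℓ c_ℓ(E) + s + e` (index),
`a ≤ ord_p #Ш(E/ℚ)`, `b ≤ ord_p #Ш(E^{d_K}/ℚ)` (descent / exhibited classes) with `a + b = 2e`. Then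
`ord_p #Ш(E/ℚ) = a` and `ord_p #Ш(E^{d_K}/ℚ) = b`. CONDITIONAL on `hglob` (displayed) and the named facts.
[cite: Jetchev2008, Cor. 1.5 and (1) (p. 812)] [cite: JetchevSkinnerWan2017, §7.4.1 (arXiv:1512.06894 p. 30)] -/
theorem padicValNat_shaOrder_eq_of_globalDivisibility_of_certificates
    (hGZ : ∀ (N : ℕ) [NeZero N] (W : WeierstrassCurve ℚ) (K : Type) [Field K] [NumberField K],
      gross_zagier N W K)
    (hKo : ∀ (N : ℕ) [NeZero N] (W : WeierstrassCurve ℚ) (K : Type) [Field K] [NumberField K],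
      kolyvagin N W K)
    (hGZK : rank_eq_analyticRank_of_analyticRank_le_one) (hmod : hasEntireLFunction_rat)
    (hMN : MatarNekovar2019.thm07_padicValNat_card_sha_primary_add_le_of_globalDivisibility_of_irreducible)
    (W : WeierstrassCurve ℚ) [W.IsElliptic] [W.IsGloballyMinimal] [NeZero (W.conductorNorm ℤ)]
    (hCM : ¬ W.HasCM) (p : ℕ) [Fact p.Prime] (hp2 : p ≠ 2) (hirr : W.HasIrreducibleModPGaloisRep p)
    (hr : W.analyticRank = 1)
    (K : Type) [Field K] [NumberField K] (hK : IsImaginaryQuadratic K)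
    (h3 : NumberField.discr K ≠ -3) (h4 : NumberField.discr K ≠ -4)
    (hHH : SatisfiesHeegnerHypothesis (W.conductorNorm ℤ) K)
    (Dt : ModularParametrizationData W (W.conductorNorm ℤ))
    (H : HeegnerDatum (W.conductorNorm ℤ) (NumberField.discr K)) (ι : K →+* ℂ)
    (P : (W.baseChange K).toAffine.Point) (Wd : WeierstrassCurve ℚ) [Wd.IsElliptic]
    (hLd : (W.quadraticTwist (NumberField.discr K : ℚ)).entireLFunction 1 ≠ 0)
    (hP : WeierstrassCurve.Affine.Point.map ι.toRatAlgHom P = heegnerPointComplex Dt H)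
    (hC : ∃ C : VariableChange ℚ, C • W.quadraticTwist (NumberField.discr K : ℚ) = Wd) {s : ℕ}
    (hglob : ∀ (s' : ℕ), s' ≤ padicValNat p W.tamagawaProduct + s →
      ∀ (n : ℕ) (d : KolyvaginHeegnerData Dt H.β ι n), Squarefree n →
        (∀ ℓ ∈ n.primeFactors, Zhang2014.IsKolyvaginPrime (W.conductorNorm ℤ) W K p ℓ ∧
          s' ≤ Zhang2014.kolyvaginIndex W p ℓ) → Koly.PDiv d p s')
    {e a b : ℕ} (hI : padicValNat p (AddSubgroup.zmultiples P).index ≤ padicValNat p W.tamagawaProduct + s + e)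
    (ha : a ≤ padicValNat p W.shaOrder) (hb : b ≤ padicValNat p Wd.shaOrder) (hab : a + b = 2 * e) :
    padicValNat p W.shaOrder = a ∧ padicValNat p Wd.shaOrder = b := by
  have hJ := padicValNat_shaOrder_add_twist_le_of_globalDivisibility hGZ hKo hGZK hmod hMN W hCM p hp2 hirr hr
    K hK h3 h4 hHH Dt H ι P Wd hLd hP hC hglob
  omega

/-- **`BSD_p(E)` from J + certificates (INDEX-EXCESS / SHA3-AN shape).** Data as in §2, `W` globally minimal;
certificates: index excess `e`, lower bounds `a ≤ ord_p #Ш(E/ℚ)`, `b ≤ ord_p #Ш(E^{d_K}/ℚ)` with `a + b = 2e`,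
and the analytic certificate `#Ш_an(E) = q`, `ord_p q = a`. Then `BSDp W p` (GZK: `Ш(E/ℚ)` finite, rank `1`;
Miller's last clause with both sides `= a`). The INDEX-EXCESS rows of the census are `a = 0`, `b = 2e = 2(i−t)`
(a `p`-descent on `E^{d_K}`); the SHA3-AN rows `a = 2`. NO main-conjecture input, NO rank-zero leaf.
CONDITIONAL; per pair; books nothing by itself. [cite: Jetchev2008, Conj. 1.3 and Cor. 1.5 (p. 812)]
[cite: Miller2011LMS, Def. 1.1] [cite: MatarNekovar2019, Thm. 0.7 (p. 456) and §0.11 (p. 457)] -/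
theorem bsdp_of_globalDivisibility_of_excess_certificates
    (hGZ : ∀ (N : ℕ) [NeZero N] (W : WeierstrassCurve ℚ) (K : Type) [Field K] [NumberField K],
      gross_zagier N W K)
    (hKo : ∀ (N : ℕ) [NeZero N] (W : WeierstrassCurve ℚ) (K : Type) [Field K] [NumberField K],
      kolyvagin N W K)
    (hGZK : rank_eq_analyticRank_of_analyticRank_le_one) (hmod : hasEntireLFunction_rat)
    (hMN : MatarNekovar2019.thm07_padicValNat_card_sha_primary_add_le_of_globalDivisibility_of_irreducible)
    (W : WeierstrassCurve ℚ) [W.IsElliptic] [W.IsGloballyMinimal] [NeZero (W.conductorNorm ℤ)]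
    (hCM : ¬ W.HasCM) (p : ℕ) [Fact p.Prime] (hp2 : p ≠ 2) (hirr : W.HasIrreducibleModPGaloisRep p)
    (hr : W.analyticRank = 1)
    (K : Type) [Field K] [NumberField K] (hK : IsImaginaryQuadratic K)
    (h3 : NumberField.discr K ≠ -3) (h4 : NumberField.discr K ≠ -4)
    (hHH : SatisfiesHeegnerHypothesis (W.conductorNorm ℤ) K)
    (Dt : ModularParametrizationData W (W.conductorNorm ℤ))
    (H : HeegnerDatum (W.conductorNorm ℤ) (NumberField.discr K)) (ι : K →+* ℂ)
    (P : (W.baseChange K).toAffine.Point) (Wd : WeierstrassCurve ℚ) [Wd.IsElliptic]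
    (hLd : (W.quadraticTwist (NumberField.discr K : ℚ)).entireLFunction 1 ≠ 0)
    (hP : WeierstrassCurve.Affine.Point.map ι.toRatAlgHom P = heegnerPointComplex Dt H)
    (hC : ∃ C : VariableChange ℚ, C • W.quadraticTwist (NumberField.discr K : ℚ) = Wd) {s : ℕ}
    (hglob : ∀ (s' : ℕ), s' ≤ padicValNat p W.tamagawaProduct + s →
      ∀ (n : ℕ) (d : KolyvaginHeegnerData Dt H.β ι n), Squarefree n →
        (∀ ℓ ∈ n.primeFactors, Zhang2014.IsKolyvaginPrime (W.conductorNorm ℤ) W K p ℓ ∧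
          s' ≤ Zhang2014.kolyvaginIndex W p ℓ) → Koly.PDiv d p s')
    {e a b : ℕ} (hI : padicValNat p (AddSubgroup.zmultiples P).index ≤ padicValNat p W.tamagawaProduct + s + e)
    (ha : a ≤ padicValNat p W.shaOrder) (hb : b ≤ padicValNat p Wd.shaOrder) (hab : a + b = 2 * e)
    {q : ℚ} (hq : shaAn W = (q : ℂ)) (hv : padicValRat p q = a) :
    BSDp W p := by
  obtain ⟨hWa, -⟩ := padicValNat_shaOrder_eq_of_globalDivisibility_of_certificates hGZ hKo hGZK hmod hMN W
    hCM p hp2 hirr hr K hK h3 h4 hHH Dt H ι P Wd hLd hP hC hglob hI ha hb hab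
  exact bsdp_of_missingPPartAt W p hGZK hr.le ⟨q, hq, by rw [hv, hWa]⟩

/-- **`BSD_p(E^{d_K})` (the rank-ZERO twist, any globally minimal model `Wd`) from J + certificates.** Same
data and certificates as `bsdp_of_globalDivisibility_of_excess_certificates`, with the analytic certificate
on the twist's side: `#Ш_an(Wd) = qd`, `ord_p qd = b`. Then `BSDp Wd p` (analytic rank `0`). CONDITIONAL; per
pair. [cite: Jetchev2008, Conj. 1.3 and Cor. 1.5 (p. 812)] [cite: Miller2011LMS, Def. 1.1]
[cite: JetchevSkinnerWan2017, §7.4.1 (arXiv:1512.06894 p. 30)] -/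
theorem partner_bsdp_of_globalDivisibility_of_excess_certificates
    (hGZ : ∀ (N : ℕ) [NeZero N] (W : WeierstrassCurve ℚ) (K : Type) [Field K] [NumberField K],
      gross_zagier N W K)
    (hKo : ∀ (N : ℕ) [NeZero N] (W : WeierstrassCurve ℚ) (K : Type) [Field K] [NumberField K],
      kolyvagin N W K)
    (hGZK : rank_eq_analyticRank_of_analyticRank_le_one) (hmod : hasEntireLFunction_rat)
    (hMN : MatarNekovar2019.thm07_padicValNat_card_sha_primary_add_le_of_globalDivisibility_of_irreducible)
    (W : WeierstrassCurve ℚ) [W.IsElliptic] [W.IsGloballyMinimal] [NeZero (W.conductorNorm ℤ)]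
    (hCM : ¬ W.HasCM) (p : ℕ) [Fact p.Prime] (hp2 : p ≠ 2) (hirr : W.HasIrreducibleModPGaloisRep p)
    (hr : W.analyticRank = 1)
    (K : Type) [Field K] [NumberField K] (hK : IsImaginaryQuadratic K)
    (h3 : NumberField.discr K ≠ -3) (h4 : NumberField.discr K ≠ -4)
    (hHH : SatisfiesHeegnerHypothesis (W.conductorNorm ℤ) K)
    (Dt : ModularParametrizationData W (W.conductorNorm ℤ))
    (H : HeegnerDatum (W.conductorNorm ℤ) (NumberField.discr K)) (ι : K →+* ℂ)
    (P : (W.baseChange K).toAffine.Point) (Wd : WeierstrassCurve ℚ) [Wd.IsElliptic] [Wd.IsGloballyMinimal]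
    (hLd : (W.quadraticTwist (NumberField.discr K : ℚ)).entireLFunction 1 ≠ 0)
    (hP : WeierstrassCurve.Affine.Point.map ι.toRatAlgHom P = heegnerPointComplex Dt H)
    (hC : ∃ C : VariableChange ℚ, C • W.quadraticTwist (NumberField.discr K : ℚ) = Wd) {s : ℕ}
    (hglob : ∀ (s' : ℕ), s' ≤ padicValNat p W.tamagawaProduct + s →
      ∀ (n : ℕ) (d : KolyvaginHeegnerData Dt H.β ι n), Squarefree n →
        (∀ ℓ ∈ n.primeFactors, Zhang2014.IsKolyvaginPrime (W.conductorNorm ℤ) W K p ℓ ∧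
          s' ≤ Zhang2014.kolyvaginIndex W p ℓ) → Koly.PDiv d p s')
    {e a b : ℕ} (hI : padicValNat p (AddSubgroup.zmultiples P).index ≤ padicValNat p W.tamagawaProduct + s + e)
    (ha : a ≤ padicValNat p W.shaOrder) (hb : b ≤ padicValNat p Wd.shaOrder) (hab : a + b = 2 * e)
    {qd : ℚ} (hqd : shaAn Wd = (qd : ℂ)) (hvd : padicValRat p qd = b) :
    BSDp Wd p := by
  obtain ⟨-, hWb⟩ := padicValNat_shaOrder_eq_of_globalDivisibility_of_certificates hGZ hKo hGZK hmod hMN W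
    hCM p hp2 hirr hr K hK h3 h4 hHH Dt H ι P Wd hLd hP hC hglob hI ha hb hab
  -- the twist has analytic rank `0`
  obtain ⟨Cd, hCd⟩ := hC
  have hD0 : (NumberField.discr K : ℚ) ≠ 0 := by exact_mod_cast NumberField.discr_ne_zero K
  haveI : (W.quadraticTwist (NumberField.discr K : ℚ)).IsElliptic := W.isElliptic_quadraticTwist hD0
  have hLd1 : Wd.entireLFunction 1 ≠ 0 := by rw [← hCd, entireLFunction_smul]; exact hLd
  have hrd : Wd.analyticRank = 0 := analyticRank_eq_zero_of_entireLFunction_one_ne_zero Wd hLd1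
  exact bsdp_of_missingPPartAt Wd p hGZK (by rw [hrd]; exact zero_le_one) ⟨qd, hqd, by rw [hvd, hWb]⟩

end Summit.BirchSwinnertonDyer.BirchSwinnertonDyer.Theorems.SchneiderFree.Exact

end
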